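import Literature.AlgebraicGeometry.Motives.UniversalHyperplaneSectionFamilyFlat
import Literature.AlgebraicGeometry.HodgeTheory.LinearSectionPencilFibres
import Literature.AlgebraicGeometry.Morphisms.SmoothOfFlatFibre
import HarnessLib

/-!
# The family of hyperplane sections of the fibres of a smooth projective family, III: the good locus and the fibres

Topic `Literature/AlgebraicGeometry/Motives` (theorems only; no definitions, no named facts). For the
family of hyperplane sections of the fibres `g = (toX ≫ f, proj) : 𝒴 ⟶ S × (ℙᴺ)^*` of a smooth
projective family `f : 𝒳 ⟶ S` of `(n+1)`-folds over a smooth irreducible affine base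
(`Motives/UniversalHyperplaneSectionFamily`, `…Flat`), this file proves:

* `smoothOfRelativeDimension_morphismRestrict_of_smooth` — relative dimension bookkeeping for a
  morphism of smooth `ℂ`-schemes smooth over an open of the target;
* `exists_goodLocus` — **the good locus**: an open `G ⊆ S × (ℙᴺ)^*` over which `g` is smooth of
  relative dimension `n` and whose complex points are EXACTLY the `(t, H)` with `X_t ∩ H` (the fibre
  of `g`) smooth of dimension `n`: `G = (S × (ℙᴺ)^*) ∖ g(𝒴 ∖ sm(g))` (`g` is proper), every point of a
  smooth fibre lies in `sm(g)` (flat with smooth fibre, `flat_stalkMap_sectionFamily`), and `g|_G` has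
  relative dimension `n` by the dimension count — the scheme-theoretic "`φ = pr₂` is a submersion over
  the open set of smooth hyperplane sections" (Voisin II §3.2.2) for the fibres of a family;
* `isClosedImmersion_fiberι_toX_left`, `exists_hom_fiberOver`, `isProjectiveOver_fiberOver_sectionFamily`,
  `range_map_fiberι_toX` — the fibre of `g` over `b = (t, H)` is a closed subscheme of `𝒳` and of the
  fibre `X_t` of `f` (hence projective), whose complex points in `𝒳` are the `x ∈ X_t(ℂ)` with
  `e(x) ∈ H`.

## References

* [VoisinHodgeII2003] C. Voisin, Hodge Theory and Complex Algebraic Geometry II, CUP 2003, §3.2.2.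
* [DeJong1996] A. J. de Jong, Smoothness, semi-stability and alterations, Publ. Math. IHÉS 83 (1996), 2.8 and 4.12.
* [GortzWedhorn2020] U. Görtz, T. Wedhorn, Algebraic Geometry I, 2nd ed. (2020), Def. 6.14, Prop. 6.15.
-/

noncomputable section

open CategoryTheory CategoryTheory.Limits AlgebraicGeometry TopologicalSpace MonoidalCategory
  CartesianMonoidalCategory
open Literature.AlgebraicGeometry.HodgeTheory
open Literature.AlgebraicGeometry.Motives.UniversalHyperplaneSection

universe u

namespace Literature.AlgebraicGeometry.Motives.SectionFamily

/-! ### The good locus `G ⊆ S × (ℙᴺ)^*` -/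

section GoodLocus

/-- **Relative dimension bookkeeping** (as in `Motives.smoothOfRelativeDimension_morphismRestrict_of_isSmoothProjective`):
for `g : Y ⟶ B` over `ℂ` with `Y`, `B` smooth over `ℂ` of relative dimensions `k + m`, `m`, if `g` is
smooth over an open `U ⊆ B` then `g|_U` is smooth of relative dimension `k` (local relative
dimensions add up along `U ↪ B → Spec ℂ`, and the relative dimension of a smooth morphism with
non-empty source is unique). [cite: GortzWedhorn2020, Def. 6.14, Prop. 6.15 (1)] -/
theorem smoothOfRelativeDimension_morphismRestrict_of_smooth {Y B : SchemeOver ℂ} (g : Y ⟶ B)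
    {m k : ℕ} [SmoothOfRelativeDimension (k + m) Y.hom] [SmoothOfRelativeDimension m B.hom]
    (U : B.left.Opens) [Smooth (g.left ∣_ U)] : SmoothOfRelativeDimension k (g.left ∣_ U) := by
  -- adapted from `Motives.smoothOfRelativeDimension_morphismRestrict_of_isSmoothProjective`
  choose V d hxV hV using exists_opens_smoothOfRelativeDimension_of_smooth (g.left ∣_ U)
  have hd : ∀ x, d x = k := by
    intro x
    haveI := hV x
    haveI : Nonempty ((V x : Scheme.{0})) := ⟨(⟨x, hxV x⟩ : V x)⟩
    have h₁ : SmoothOfRelativeDimension (d x + (0 + m))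
        (((V x).ι ≫ g.left ∣_ U) ≫ U.ι ≫ B.hom) := inferInstance
    have heq : ((V x).ι ≫ g.left ∣_ U) ≫ U.ι ≫ B.hom = (V x).ι ≫ (g.left ⁻¹ᵁ U).ι ≫ Y.hom := by
      rw [Category.assoc, ← Category.assoc (g.left ∣_ U), morphismRestrict_ι, Category.assoc, Over.w g]
    have h₂ : SmoothOfRelativeDimension (0 + (0 + (k + m))) ((V x).ι ≫ (g.left ⁻¹ᵁ U).ι ≫ Y.hom) :=
      inferInstance
    rw [heq] at h₁
    have := AbelianVarietyProofs.eq_of_smoothOfRelativeDimension _ h₁ h₂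
    omega
  have hcov : iSup V = ⊤ := by
    rw [eq_top_iff]
    rintro x -
    exact TopologicalSpace.Opens.mem_iSup.mpr ⟨x, hxV x⟩
  exact IsZariskiLocalAtSource.of_iSup_eq_top (P := @SmoothOfRelativeDimension k) V hcov
    fun x => hd x ▸ hV x

variable {n N d : ℕ} {𝒳 S : SchemeOver ℂ} (f : 𝒳 ⟶ S) (e : 𝒳 ⟶ projectiveSpace N ℂ)

/-- **The good locus.** For a smooth projective family `f : 𝒳 ⟶ S` of `(n+1)`-folds over a smooth
irreducible affine base, an affine `e : 𝒳 ⟶ ℙᴺ` (`N ≥ 2`) and the family of hyperplane sections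
of the fibres `g = (toX ≫ f, proj) : 𝒴 ⟶ S × (ℙᴺ)^*`, there is an open `G ⊆ S × (ℙᴺ)^*` over
which `g` is smooth of relative dimension `n` and whose complex points are EXACTLY the `(t, H)` with
`X_t ∩ H` smooth of dimension `n`: `G = (S × (ℙᴺ)^*) ∖ g(𝒴 ∖ sm(g))` (`g` is proper, hence
closed), every point of a smooth fibre lies in `sm(g)` (flat with smooth fibre,
`flat_stalkMap_sectionFamily`), and `g|_G` is smooth of relative dimension `n` by the dimension
count. This is the scheme-theoretic form of "`φ = pr₂` is a submersion over the open set of smooth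
hyperplane sections" (Voisin II §3.2.2) for the fibres of a family.
[cite: VoisinHodgeII2003, §3.2.2] [cite: DeJong1996, 2.8 and 4.12] -/
theorem exists_goodLocus (hf : IsSmoothProjectiveFamily f (n + 1)) [IrreducibleSpace S.left]
    [SmoothOfRelativeDimension d S.hom] [IsAffine S.left] [IsAffineHom e.left] (hN : 2 ≤ N) :
    ∃ G : (S ⊗ dualProjectiveSpace N ℂ).left.Opens,
      SmoothOfRelativeDimension n ((CartesianMonoidalCategory.lift (toX N e ≫ f) (proj N e)).left ∣_ G) ∧
      ∀ b : ComplexPoints (S ⊗ dualProjectiveSpace N ℂ), b.pt ∈ G ↔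
        SmoothOfRelativeDimension n
          (fiberOver (CartesianMonoidalCategory.lift (toX N e ≫ f) (proj N e)) b).hom := by
  haveI : Smooth S.hom := SmoothOfRelativeDimension.smooth d _
  haveI : LocallyOfFiniteType S.hom := inferInstance
  haveI : IsSeparated S.hom := inferInstance
  haveI := smoothOfRelativeDimension_total_hom f hf (d := d)
  haveI := smoothOfRelativeDimension_section_hom (n := n) (N := N) (d := d) e
  haveI := smoothOfRelativeDimension_dualProjectiveSpace_hom (N := N)
  haveI := smoothOfRelativeDimension_tensorObj_hom S (dualProjectiveSpace N ℂ) (d := d) (m := N)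
  haveI : IsSeparated (dualProjectiveSpace N ℂ).hom := inferInstance
  haveI := isSeparated_tensorObj_hom S (dualProjectiveSpace N ℂ)
  haveI := locallyOfFiniteType_total_hom f hf
  haveI := locallyOfFinitePresentation_sectionFamily_left f e
  haveI := isProper_sectionFamily_left f e hf
  set g := CartesianMonoidalCategory.lift (toX N e ≫ f) (proj N e) with hg
  have hcl : IsClosed (g.left.base '' (g.left.smoothLocus : Set (universalHyperplaneSection N e).left)ᶜ) :=
    g.left.isClosedMap _ g.left.smoothLocus.isOpen.isClosed_compl
  let G : (S ⊗ dualProjectiveSpace N ℂ).left.Opens :=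
    ⟨(g.left.base '' (g.left.smoothLocus : Set (universalHyperplaneSection N e).left)ᶜ)ᶜ, hcl.isOpen_compl⟩
  have hGle : g.left ⁻¹ᵁ G ≤ g.left.smoothLocus := by
    intro x hx
    by_contra hxs
    exact hx ⟨x, hxs, rfl⟩
  haveI hGsm : Smooth (g.left ∣_ G) :=
    Literature.AlgebraicGeometry.Morphisms.smooth_morphismRestrict_of_preimage_le_smoothLocus g.left G hGle
  have hrel : SmoothOfRelativeDimension n (g.left ∣_ G) := by
    haveI : SmoothOfRelativeDimension (n + (N + d)) (universalHyperplaneSection N e).hom := by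
      rw [show n + (N + d) = N - 1 + (n + 1 + d) by omega]; infer_instance
    exact smoothOfRelativeDimension_morphismRestrict_of_smooth g (m := N + d) (k := n) G
  refine ⟨G, hrel, fun b => ⟨fun hb => ?_, fun hb => ?_⟩⟩
  · haveI := hrel
    exact smoothOfRelativeDimension_fiberOver_hom g G b hb
  · -- every point of the smooth fibre over `b` lies in the smooth locus
    rintro ⟨y, hy, hyb⟩
    apply hy
    obtain ⟨hsm, -⟩ := smooth_fiberToSpecResidueField_of_fiberOver g b hb
    have hsm' : Smooth (g.left.fiberToSpecResidueField (g.left.base y)) := by rw [hyb]; exact hsm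
    exact Literature.AlgebraicGeometry.Morphisms.mem_smoothLocus_of_flat_stalkMap_of_smooth_fiber g.left
      (flat_stalkMap_sectionFamily f e hf (d := d) hN b hb y hyb) hsm'

end GoodLocus


/-! ### The fibres of `g`: closed subschemes of the fibres of `f` -/

section Fibres

variable {n N : ℕ} {𝒳 S : SchemeOver ℂ} (f : 𝒳 ⟶ S) (e : 𝒳 ⟶ projectiveSpace N ℂ)
  (b : ComplexPoints (S ⊗ dualProjectiveSpace N ℂ))

/-- `Y_b ⟶ 𝒴 ⟶ 𝒳 ⟶ S` is the constant map `Y_b ⟶ Spec ℂ ⟶ S` to `t = pr₁(b)`. [folklore] -/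
theorem fiberι_toX_f :
    (fiberι (CartesianMonoidalCategory.lift (toX N e ≫ f) (proj N e)) b ≫ toX N e) ≫ f =
      fiberOverToSpec _ b ≫ AlgPoints.map (fst S (dualProjectiveSpace N ℂ)) b := by
  have h1 : toX N e ≫ f = CartesianMonoidalCategory.lift (toX N e ≫ f) (proj N e) ≫
      fst S (dualProjectiveSpace N ℂ) := (sectionFamily_fst f e).symm
  calc (fiberι (CartesianMonoidalCategory.lift (toX N e ≫ f) (proj N e)) b ≫ toX N e) ≫ f
      = fiberι (CartesianMonoidalCategory.lift (toX N e ≫ f) (proj N e)) b ≫ (toX N e ≫ f) :=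
        Category.assoc _ _ _
    _ = (fiberι (CartesianMonoidalCategory.lift (toX N e ≫ f) (proj N e)) b ≫
          CartesianMonoidalCategory.lift (toX N e ≫ f) (proj N e)) ≫ fst S (dualProjectiveSpace N ℂ) := by
        rw [Category.assoc]
        exact congrArg (fiberι _ b ≫ ·) h1
    _ = fiberOverToSpec _ b ≫ AlgPoints.map (fst S (dualProjectiveSpace N ℂ)) b := by
        rw [fiberι_comp, Category.assoc]
        rfl

/-- `Y_b ⟶ 𝒴 ⟶ (ℙᴺ)^*` is the constant map to `H = pr₂(b)`. [folklore] -/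
theorem fiberι_proj :
    fiberι (CartesianMonoidalCategory.lift (toX N e ≫ f) (proj N e)) b ≫ proj N e =
      fiberOverToSpec _ b ≫ AlgPoints.map (snd S (dualProjectiveSpace N ℂ)) b := by
  have h1 : proj N e = CartesianMonoidalCategory.lift (toX N e ≫ f) (proj N e) ≫
      snd S (dualProjectiveSpace N ℂ) := (sectionFamily_snd f e).symm
  calc fiberι (CartesianMonoidalCategory.lift (toX N e ≫ f) (proj N e)) b ≫ proj N e
      = (fiberι (CartesianMonoidalCategory.lift (toX N e ≫ f) (proj N e)) b ≫
          CartesianMonoidalCategory.lift (toX N e ≫ f) (proj N e)) ≫ snd S (dualProjectiveSpace N ℂ) := by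
        rw [Category.assoc]
        exact congrArg (fiberι _ b ≫ ·) h1
    _ = fiberOverToSpec _ b ≫ AlgPoints.map (snd S (dualProjectiveSpace N ℂ)) b := by
        rw [fiberι_comp, Category.assoc]
        rfl

/-- `Y_b ⟶ 𝒴 ⟶ 𝒳 × (ℙᴺ)^*` is `(Y_b ⟶ 𝒳) ≫ (slice at H)`. [folklore] -/
theorem fiberι_emb_eq_sliceAt :
    fiberι (CartesianMonoidalCategory.lift (toX N e ≫ f) (proj N e)) b ≫ emb N e =
      (fiberι (CartesianMonoidalCategory.lift (toX N e ≫ f) (proj N e)) b ≫ toX N e) ≫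
        sliceAt 𝒳 (AlgPoints.map (snd S (dualProjectiveSpace N ℂ)) b) := by
  apply CartesianMonoidalCategory.hom_ext
  · rw [Category.assoc, Category.assoc, sliceAt_fst, Category.comp_id]
    rfl
  · rw [Category.assoc, Category.assoc, sliceAt_snd, ← Category.assoc _ (toSpecOver 𝒳),
      Literature.AlgebraicGeometry.Motives.eq_toSpecOver ((fiberι _ b ≫ toX N e) ≫ toSpecOver 𝒳),
      ← Literature.AlgebraicGeometry.Motives.eq_toSpecOver (fiberOverToSpec _ b), ← fiberι_proj f e b]
    rfl

/-- **`Y_b ⟶ 𝒳` is a closed immersion** (for `S` separated): `Y_b ⟶ 𝒴 ⟶ 𝒳 × (ℙᴺ)^*` is a closed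
immersion and factors through the closed immersion `𝒳 ≅ 𝒳 × {H} ⟶ 𝒳 × (ℙᴺ)^*`. [folklore] -/
theorem isClosedImmersion_fiberι_toX_left [IsSeparated S.hom] :
    IsClosedImmersion (fiberι (CartesianMonoidalCategory.lift (toX N e ≫ f) (proj N e)) b ≫ toX N e).left := by
  haveI : IsSeparated (dualProjectiveSpace N ℂ).hom := inferInstance
  haveI := isSeparated_tensorObj_hom S (dualProjectiveSpace N ℂ)
  haveI := isClosedImmersion_fiberι_left (CartesianMonoidalCategory.lift (toX N e ≫ f) (proj N e)) b
  haveI : IsClosedImmersion (sliceAt 𝒳 (AlgPoints.map (snd S (dualProjectiveSpace N ℂ)) b)).left :=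
    isClosedImmersion_sliceAt_left _
  haveI : IsClosedImmersion ((fiberι (CartesianMonoidalCategory.lift (toX N e ≫ f) (proj N e)) b ≫
      toX N e).left ≫ (sliceAt 𝒳 (AlgPoints.map (snd S (dualProjectiveSpace N ℂ)) b)).left) := by
    rw [← Over.comp_left, ← fiberι_emb_eq_sliceAt, Over.comp_left]
    infer_instance
  exact IsClosedImmersion.of_comp_isClosedImmersion _
    (sliceAt 𝒳 (AlgPoints.map (snd S (dualProjectiveSpace N ℂ)) b)).left

/-- **The fibre `Y_b` of `g` over `b = (t, H)` is a closed subscheme of the fibre `X_t` of `f`**: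
there is a closed immersion `v : Y_b ⟶ X_t` over `𝒳`. [folklore] -/
theorem exists_hom_fiberOver [IsSeparated S.hom] :
    ∃ v : fiberOver (CartesianMonoidalCategory.lift (toX N e ≫ f) (proj N e)) b ⟶
        fiberOver f (AlgPoints.map (fst S (dualProjectiveSpace N ℂ)) b),
      IsClosedImmersion v.left ∧
        v ≫ fiberι f (AlgPoints.map (fst S (dualProjectiveSpace N ℂ)) b) =
          fiberι (CartesianMonoidalCategory.lift (toX N e ≫ f) (proj N e)) b ≫ toX N e := by
  set g := CartesianMonoidalCategory.lift (toX N e ≫ f) (proj N e) with hg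
  set t := AlgPoints.map (fst S (dualProjectiveSpace N ℂ)) b with ht
  set u := fiberι g b ≫ toX N e with hu
  have hw : u.left ≫ f.left = pullback.snd g.left b.left ≫ t.left := by
    have h := congrArg Over.Hom.left (fiberι_toX_f f e b)
    simp only [Over.comp_left] at h
    exact h
  let v : fiberOver g b ⟶ fiberOver f t :=
    Over.homMk (pullback.lift u.left (pullback.snd g.left b.left) hw) (by
      change pullback.lift u.left (pullback.snd g.left b.left) hw ≫ pullback.fst f.left t.left ≫ 𝒳.hom =
        (fiberOver g b).hom
      rw [pullback.lift_fst_assoc]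
      exact Over.w u)
  have hv : v ≫ fiberι f t = u := by
    ext : 1
    exact pullback.lift_fst _ _ _
  refine ⟨v, ?_, hv⟩
  haveI := isClosedImmersion_fiberι_left f t
  haveI : IsClosedImmersion (v.left ≫ (fiberι f t).left) := by
    rw [← Over.comp_left, hv]
    exact isClosedImmersion_fiberι_toX_left f e b
  exact IsClosedImmersion.of_comp_isClosedImmersion _ (fiberι f t).left

/-- The fibres of `g` are projective over `ℂ` (closed subschemes of the projective fibres of `f`).
[folklore] -/
theorem isProjectiveOver_fiberOver_sectionFamily [IsSeparated S.hom] (hf : IsSmoothProjectiveFamily f n) :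
    IsProjectiveOver (fiberOver (CartesianMonoidalCategory.lift (toX N e ≫ f) (proj N e)) b) := by
  obtain ⟨v, hv, -⟩ := exists_hom_fiberOver f e b
  obtain ⟨M, κ, hκ⟩ := (hf.isSmoothProjective (AlgPoints.map (fst S (dualProjectiveSpace N ℂ)) b)).isProjectiveOver
  haveI := hv
  haveI := hκ
  exact ⟨M, v ≫ κ, by rw [Over.comp_left]; infer_instance⟩


/-- A complex point of `Spec ℂ` over `ℂ` is the identity. [folklore] -/
theorem map_fiberOverToSpec_eq {Y B T : SchemeOver ℂ} (g : Y ⟶ B) (b : ComplexPoints B)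
    (z : ComplexPoints (fiberOver g b)) (t : ComplexPoints T) :
    AlgPoints.map (fiberOverToSpec g b ≫ t) z = t := by
  rw [AlgPoints.map_comp_apply, AlgPoints.map_apply,
    LinearSectionNet.eq_id_of_specOver_self (AlgPoints.map (fiberOverToSpec g b) z), Category.id_comp]

/-- **The complex points of the fibre of `g` over `b = (t, H)`, in `𝒳`, are the complex points `x`
of `X_t` with `e(x) ∈ H`** (incidence locus). [cite: VoisinHodgeII2003, §3.2.2] -/
theorem range_map_fiberι_toX :
    Set.range (AlgPoints.map (L := ℂ)
        (fiberι (CartesianMonoidalCategory.lift (toX N e ≫ f) (proj N e)) b ≫ toX N e)) =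
      {x : ComplexPoints 𝒳 | AlgPoints.map f x = AlgPoints.map (fst S (dualProjectiveSpace N ℂ)) b ∧
        AlgPoints.pt (CartesianMonoidalCategory.lift x (AlgPoints.map (snd S (dualProjectiveSpace N ℂ)) b)) ∈
          (incidenceLocus N e : Set (𝒳 ⊗ dualProjectiveSpace N ℂ).left)} := by
  set g := CartesianMonoidalCategory.lift (toX N e ≫ f) (proj N e) with hg
  set t := AlgPoints.map (fst S (dualProjectiveSpace N ℂ)) b with ht
  set H := AlgPoints.map (snd S (dualProjectiveSpace N ℂ)) b with hH
  have hemb : ∀ y : ComplexPoints (universalHyperplaneSection N e),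
      AlgPoints.map (emb N e) y =
        CartesianMonoidalCategory.lift (AlgPoints.map (toX N e) y) (AlgPoints.map (proj N e) y) := by
    intro y
    rw [eq_lift_map_fst_map_snd (AlgPoints.map (emb N e) y), ← AlgPoints.map_comp_apply,
      ← AlgPoints.map_comp_apply]
    rfl
  ext x
  constructor
  · rintro ⟨z, rfl⟩
    refine ⟨?_, ?_⟩
    · rw [← AlgPoints.map_comp_apply, fiberι_toX_f f e b, map_fiberOverToSpec_eq]
    · have hproj : AlgPoints.map (proj N e) (AlgPoints.map (fiberι g b) z) = H := by
        rw [← AlgPoints.map_comp_apply, fiberι_proj f e b, map_fiberOverToSpec_eq]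
      have hx : AlgPoints.map (fiberι g b ≫ toX N e) z = AlgPoints.map (toX N e) (AlgPoints.map (fiberι g b) z) := by
        rw [AlgPoints.map_comp_apply]
      rw [hx, ← hproj, ← hemb, AlgPoints.pt_map, ← range_emb]
      exact ⟨_, rfl⟩
  · rintro ⟨hxt, hxH⟩
    rw [← range_emb] at hxH
    set y := AlgPoints.liftClosed (emb N e) (CartesianMonoidalCategory.lift x H) hxH with hy
    have hy' : AlgPoints.map (emb N e) y = CartesianMonoidalCategory.lift x H := AlgPoints.map_liftClosed _ _ hxH
    have hyX : AlgPoints.map (toX N e) y = x := by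
      change AlgPoints.map (emb N e ≫ fst _ _) y = x
      rw [AlgPoints.map_comp_apply, hy', AlgPoints.map_apply, CartesianMonoidalCategory.lift_fst]
    have hyP : AlgPoints.map (proj N e) y = H := by
      change AlgPoints.map (emb N e ≫ snd _ _) y = H
      rw [AlgPoints.map_comp_apply, hy', AlgPoints.map_apply, CartesianMonoidalCategory.lift_snd]
    have hgy : AlgPoints.map g y = b := by
      rw [eq_lift_map_fst_map_snd (AlgPoints.map g y), eq_lift_map_fst_map_snd b,
        ← AlgPoints.map_comp_apply, ← AlgPoints.map_comp_apply, hg, CartesianMonoidalCategory.lift_fst,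
        CartesianMonoidalCategory.lift_snd, AlgPoints.map_comp_apply, hyX, hyP, hxt]
    obtain ⟨z, hz⟩ : y ∈ Set.range (AlgPoints.map (fiberι g b)) := by
      rw [AlgPoints.range_map_fiberι]; exact hgy
    exact ⟨z, by rw [AlgPoints.map_comp_apply, hz, hyX]⟩

end Fibres

end Literature.AlgebraicGeometry.Motives.SectionFamily

end
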